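import Mathlib.Data.Int.CardIntervalMod
import Mathlib.Data.Nat.Count
import Literature.Computability.Cryptography.FiniteHybrids
import HarnessLib

/-!
# Reducing a uniform number below `B` modulo `Q` is `(B mod Q)/B ≤ Q/B`-close to uniform

The standard smoothing fact used to sample (almost) uniform elements of `ℤ_Q` from uniform bit
strings (Naor–Reingold 2004, Construction 4.1 samples `a_i ∈ ℤ_Q` uniformly; with `B = 2^L` one
uses `L`-bit strings): if `K` is uniform in `{0, …, B-1}` then, for every event `e ⊆ ℤ_Q`,
`|Pr_K[e (K mod Q)] - Pr_{v ∈ ℤ_Q}[e v]| ≤ (B mod Q)/B` (`abs_uProb_finMod_sub_le_mod`), hence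
`≤ Q/B` (`abs_uProb_finMod_sub_le`). Proof: every residue class meets `{0, …, B-1}` in `⌊B/Q⌋` or
`⌊B/Q⌋ + 1` points (`Nat.count_modEq_card`). The reduction map `finMod hQ K = ⟨K mod Q, _⟩` is
core's `Fin.ofNat Q K` with the instance argument `[NeZero Q]` replaced by the hypothesis
`0 < Q` (`finMod_eq_ofNat`, `rfl`); it is an `abbrev`, so the `Fin.ofNat` / `Fin.val_natCast`
`simp` API applies to it.

## References

* M. Naor, O. Reingold, J. ACM 51 (2004), Construction 4.1 (p. 245) (the key exponents are
  uniform in `ℤ_Q`).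
-/

noncomputable section

namespace Literature.Computability.Cryptography

open Finset

/-- The residue of `K < B` modulo `Q > 0`, as an element of `Fin Q`: this is core's `Fin.ofNat Q K`
(`= ⟨K % Q, _⟩`) with the hypothesis `0 < Q` in place of the instance `[NeZero Q]`
(`finMod_eq_ofNat`). [folklore] -/
abbrev finMod {B Q : ℕ} (hQ : 0 < Q) (K : Fin B) : Fin Q := ⟨K.val % Q, Nat.mod_lt _ hQ⟩

/-- `finMod` is `Fin.ofNat`. [folklore] -/
@[simp] theorem finMod_eq_ofNat {B Q : ℕ} (hQ : 0 < Q) (K : Fin B) :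
    finMod hQ K = @Fin.ofNat Q ⟨hQ.ne'⟩ K.val := rfl

/-- The value of `finMod`. [folklore] -/
theorem val_finMod {B Q : ℕ} (hQ : 0 < Q) (K : Fin B) : (finMod hQ K).val = K.val % Q := rfl

/-- Counting over `Fin B` is counting over `range B`. [folklore] -/
theorem card_filter_fin_eq_card_filter_range {B : ℕ} (P : ℕ → Prop) [DecidablePred P] :
    #{K : Fin B | P K.val} = #{K ∈ range B | P K} := by
  rw [← Finset.card_map Fin.valEmbedding]
  congr 1
  ext K
  simp only [mem_map, mem_filter, mem_univ, true_and, Fin.valEmbedding_apply, mem_range]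
  constructor
  · rintro ⟨K', hK', rfl⟩; exact ⟨K'.isLt, hK'⟩
  · rintro ⟨hK, hP⟩; exact ⟨⟨K, hK⟩, hP, rfl⟩

/-- **Fibres of reduction mod `Q`**: the number of `K < B` with `K mod Q = v` (`v < Q`) is
`⌊B/Q⌋ + [v < B mod Q]`. [folklore] -/
theorem card_filter_mod_eq {B Q : ℕ} (hQ : 0 < Q) (v : Fin Q) :
    #{K : Fin B | K.val % Q = v.val} = B / Q + if v.val < B % Q then 1 else 0 := by
  rw [card_filter_fin_eq_card_filter_range (fun K => K % Q = v.val)]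
  have h := Nat.count_modEq_card B hQ v.val
  rw [Nat.count_eq_card_filter_range, Nat.mod_eq_of_lt v.isLt] at h
  rw [← h]
  congr 1
  ext K
  simp only [mem_filter, mem_range, and_congr_right_iff]
  intro _
  simp [Nat.ModEq, Nat.mod_eq_of_lt v.isLt]

/-- Counting an event through reduction mod `Q`, fibrewise:
`#{K < B | e (K mod Q)} = ⌊B/Q⌋ · #{v | e v} + #{v < B mod Q | e v}`. [folklore] -/
theorem card_filter_comp_finMod {B Q : ℕ} (hQ : 0 < Q) (e : Fin Q → Bool) :
    #{K : Fin B | e (finMod hQ K) = true} =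
      B / Q * #{v : Fin Q | e v = true} + #{v : Fin Q | e v = true ∧ v.val < B % Q} := by
  rw [card_eq_sum_card_fiberwise (f := finMod (B := B) hQ) (t := univ.filter fun v : Fin Q => e v = true)
    (fun K hK => by simpa using hK)]
  have hfib : ∀ v : Fin Q, e v = true →
      #{K ∈ univ.filter (fun K : Fin B => e (finMod hQ K) = true) | finMod hQ K = v} =
        B / Q + if v.val < B % Q then 1 else 0 := by
    intro v hv
    rw [← card_filter_mod_eq hQ v, Finset.filter_filter]
    congr 1
    ext K
    simp only [mem_filter, mem_univ, true_and, finMod, Fin.ext_iff]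
    constructor
    · rintro ⟨_, h⟩; exact h
    · intro h; exact ⟨by rw [show (⟨K.val % Q, Nat.mod_lt _ hQ⟩ : Fin Q) = v from Fin.ext h]; exact hv, h⟩
  rw [Finset.sum_congr rfl fun v hv => hfib v (by simpa using hv), Finset.sum_add_distrib,
    Finset.sum_const, smul_eq_mul, mul_comm, Finset.sum_ite, Finset.sum_const_zero, add_zero,
    Finset.sum_const, smul_eq_mul, mul_one, Finset.filter_filter]

/-- **Reduction mod `Q` is close to uniform (sharp form)**: for `K` uniform in `{0, …, B-1}`
(`B > 0`) and any event `e` on `ℤ_Q`, `|Pr_K[e (K mod Q)] - Pr_v[e v]| ≤ (B mod Q) / B`. [folklore] -/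
theorem abs_uProb_finMod_sub_le_mod {B Q : ℕ} (hQ : 0 < Q) (hB : 0 < B) (e : Fin Q → Bool) :
    |uProb (fun K : Fin B => e (finMod hQ K)) - uProb e| ≤ ((B % Q : ℕ) : ℝ) / B := by
  unfold uProb
  rw [card_filter_comp_finMod hQ e, Fintype.card_fin, Fintype.card_fin]
  set A : ℕ := #{v : Fin Q | e v = true} with hA
  set A' : ℕ := #{v : Fin Q | e v = true ∧ v.val < B % Q} with hA'
  set q : ℕ := B / Q with hq
  set ρ : ℕ := B % Q with hρ
  have hBq : (B : ℝ) = q * Q + ρ := by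
    rw [hq, hρ]; exact_mod_cast (Nat.div_add_mod' B Q).symm
  have hA_le : (A : ℝ) ≤ Q := by
    rw [hA]; exact_mod_cast (card_filter_le _ _).trans (by simp)
  have hA'_le : (A' : ℝ) ≤ ρ := by
    rw [hA', hρ]
    have : #{v : Fin Q | e v = true ∧ v.val < B % Q} ≤ #{v : Fin Q | v.val < B % Q} :=
      card_le_card (fun v hv => by simp only [mem_filter, mem_univ, true_and] at hv ⊢; exact hv.2)
    refine (Nat.cast_le.2 this).trans ?_
    rw [card_filter_fin_eq_card_filter_range (fun v => v < B % Q)]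
    have : #{v ∈ range Q | v < B % Q} ≤ #(range (B % Q)) :=
      card_le_card fun v hv => by simp only [mem_filter, mem_range] at hv ⊢; exact hv.2
    exact_mod_cast this.trans (by simp)
  have hA0 : (0 : ℝ) ≤ A := Nat.cast_nonneg _
  have hA'0 : (0 : ℝ) ≤ A' := Nat.cast_nonneg _
  have hρQ : (ρ : ℝ) ≤ Q := by rw [hρ]; exact_mod_cast (Nat.mod_lt B hQ).le
  have hρ0 : (0 : ℝ) ≤ ρ := Nat.cast_nonneg _
  have hQpos : (0 : ℝ) < Q := by exact_mod_cast hQ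
  have hBpos : (0 : ℝ) < B := by exact_mod_cast hB
  have key : ((q * A + A' : ℕ) : ℝ) / B - (A : ℝ) / Q = (Q * A' - ρ * A) / (B * Q) := by
    have hB0 : (B : ℝ) ≠ 0 := hBpos.ne'
    have hQ0 : (Q : ℝ) ≠ 0 := hQpos.ne'
    rw [div_sub_div _ _ hB0 hQ0, div_eq_div_iff (mul_ne_zero hB0 hQ0) (mul_ne_zero hB0 hQ0)]
    push_cast
    rw [hBq]
    ring
  rw [key, abs_div, abs_of_pos (by positivity : (0 : ℝ) < B * Q), div_le_div_iff₀ (by positivity) hBpos]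
  have h1 : |(Q : ℝ) * A' - ρ * A| ≤ ρ * Q := by
    rw [abs_sub_le_iff]
    constructor <;> nlinarith
  calc |(Q : ℝ) * A' - ρ * A| * B ≤ ρ * Q * B := by
        exact mul_le_mul_of_nonneg_right h1 hBpos.le
    _ = ρ * (B * Q) := by ring

/-- **Reduction mod `Q` is close to uniform**: `|Pr_K[e (K mod Q)] - Pr_v[e v]| ≤ Q / B`
(the form consumed downstream; from the sharp form and `B mod Q < Q`). [folklore] -/
theorem abs_uProb_finMod_sub_le {B Q : ℕ} (hQ : 0 < Q) (hB : 0 < B) (e : Fin Q → Bool) :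
    |uProb (fun K : Fin B => e (finMod hQ K)) - uProb e| ≤ (Q : ℝ) / B := by
  refine (abs_uProb_finMod_sub_le_mod hQ hB e).trans ?_
  have : ((B % Q : ℕ) : ℝ) ≤ Q := by exact_mod_cast (Nat.mod_lt B hQ).le
  exact div_le_div_of_nonneg_right this (by positivity)

end Literature.Computability.Cryptography

end
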